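import Summits.RiemannHypothesis.RiemannHypothesis.Theorems.GroundBartaEvenWinsBeyondArchDeflationCore
import HarnessLib

/-!
# RiemannHypothesis / GroundBarta — rung 4 (`EvenWinsBeyondArch`, stmt-RiemannHypothesis-18807 / 18085):
# the deflated Temple L-side with a WEIGHTED complement level — core inclusion

Helper file (`--supports stmt-RiemannHypothesis-18085`), RH-free, no definitions, no named facts.  Prover A (gen 4 of
unit `sr-gb-rung-a`).

The deflated Temple (Lehmann–Maehly) inclusion of file III (`dt_deflation_core`) uses a SCALAR complement level:
`β ∫|h|² ≤ E(h,h)` for `h ⊥ v`, and concludes from `(β − λ)(A − λG) − R ⪰ 0`.  On the parity-ladder cells beyond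
`log 2` the level is `β = β₂₃ − (log 2)/2`, the `(log 2)/2` being the three-prime sliver — which in truth only charges the
EDGE mass `∫_{|y| ≥ log 4 − c} |h|²` (Cauchy–Schwarz on the overlap of `h` and `h(· − log 4)`).  This file carries a
POINTWISE level `m(y) = n(y) + λ` through the argument: if `∫ n|h|² + λ∫|h|² ≤ E(h,h)` for `h ⊥ v` (`n ≥ 0` bounded
measurable, `w = 1/n` bounded) then `λ ≤` the sector bottom as soon as

  `A − λ G − R_w ⪰ 0`,  `R_w,ij = ∫ w(y) · Re(r_i(y) r̄_j(y)) dy`  (residuals `r_i = F_i − Σ_l W_il v_l`),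

by completing the square pointwise (`2 Re(x ȳ) ≥ −w|x|² − n|y|²` when `w n = 1`).  With `n ≡ β − λ` this is file III
divided by `β − λ`; with the two-level weight of the refined sliver the interior residual mass is charged
`1/(β₂₃ − λ)` instead of `1/(β₂₃ − (log 2)/2 − λ)` (at `b = 0.77`: `Σ s_i/T_i` 1.10 → 0.56 on the certified data).

* `dt_deflatedFormBound₂W` — the abstract two-space inequality with scaling maps `S_w`, `S_n`, `ip (S_w x) (S_n y) = ip x y`;
* `dt_memLp_real_mul` — `y ↦ u(y) f(y) ∈ L²` for bounded measurable real `u`, `f ∈ L²`;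
* **`dt_deflation_core_w`** — the weighted inclusion on the sector form domain of the window.
-/

set_option linter.dupNamespace false

noncomputable section

open MeasureTheory Set Filter
open scoped Topology ENNReal NNReal ComplexConjugate InnerProductSpace BigOperators

namespace Summit.RiemannHypothesis.RiemannHypothesis.Theorems.EvenWinsBeyondArch

open Literature.NumberTheory.LFunctions Literature.NumberTheory.LFunctions.ConnesVanSuijlekom
open Summit.RiemannHypothesis.RiemannHypothesis.Theorems.OddSector
  (weilIncrement₂ weilDirichletEnergy₂ weilPoleForm₂ weilIncrement₂_self weilDirichletEnergy₂_self
    weilPoleForm₂_self re_mul_conj_self)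

/-! ## The abstract weighted inequality -/

/-- **Deflated Temple–Kato bound with a pointwise complement level (two-space form).**  As `dt_deflatedFormBound₂`
but the complement bound is `ip (S_n ιh) (S_n ιh) + λ ip (ιh) (ιh) ≤ E(h,h)` and the residual Gram matrix is taken
through `S_w`, where the linear maps `S_w, S_n : D' → D'` satisfy `ip (S_w x) (S_n y) = ip x y` (multiplication by
`√w`, `√n`, `w n = 1`); the PSD datum is `A − λ G − R_w ⪰ 0`.  Three lines: expand, complete the square, use the datum.
[cite: WeinsteinStenger1972, Ch. 5 §9 eq. (2) (k = 1: Temple's formula)] -/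
theorem dt_deflatedFormBound₂W {D D' : Type*} [AddCommGroup D] [Module ℝ D] [AddCommGroup D'] [Module ℝ D']
    (ι : D →ₗ[ℝ] D') (ip : D' →ₗ[ℝ] D' →ₗ[ℝ] ℝ) (E : D →ₗ[ℝ] D →ₗ[ℝ] ℝ)
    (hip_symm : ∀ x y, ip x y = ip y x) (hip_nonneg : ∀ x, 0 ≤ ip x x) (hE_symm : ∀ x y, E x y = E y x)
    (Sw Sn : D' →ₗ[ℝ] D') (hS : ∀ x y, ip (Sw x) (Sn y) = ip x y)
    {k : ℕ} (v : Fin k → D) (r : Fin k → D') (lam : ℝ)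
    (hrepr : ∀ i h, (∀ j, ip (ι (v j)) (ι h) = 0) → E (v i) h = ip (r i) (ι h))
    (hbeta : ∀ h, (∀ j, ip (ι (v j)) (ι h) = 0) → ip (Sn (ι h)) (Sn (ι h)) + lam * ip (ι h) (ι h) ≤ E h h)
    (hPSD : ∀ α : Fin k → ℝ,
      0 ≤ ∑ i, ∑ j, α i * α j * (E (v i) (v j) - lam * ip (ι (v i)) (ι (v j)) - ip (Sw (r i)) (Sw (r j))))
    {g h : D} {α : Fin k → ℝ} (hg : g = (∑ i, α i • v i) + h) (horth : ∀ j, ip (ι (v j)) (ι h) = 0) :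
    lam * ip (ι g) (ι g) ≤ E g g := by
  set u : D := ∑ i, α i • v i with hu
  set x : D' := ∑ i, α i • r i with hx
  have hιu : ι u = ∑ i, α i • ι (v i) := by rw [hu, map_sum]; simp [map_smul]
  have hSx : Sw x = ∑ i, α i • Sw (r i) := by rw [hx, map_sum]; simp [map_smul]
  have hEuh : E u h = ip x (ι h) := by
    rw [hu, hx, dt_bilin_sum_smul_left, dt_bilin_sum_smul_left]
    exact Finset.sum_congr rfl fun i _ ↦ by rw [hrepr i h horth]
  have hipuh : ip (ι u) (ι h) = 0 := by
    rw [hιu, dt_bilin_sum_smul_left]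
    exact Finset.sum_eq_zero fun i _ ↦ by rw [horth i, mul_zero]
  have hEgg : E g g = E u u + 2 * ip x (ι h) + E h h := by
    rw [hg]
    simp only [map_add, LinearMap.add_apply]
    rw [hE_symm h u, hEuh]
    ring
  have hipgg : ip (ι g) (ι g) = ip (ι u) (ι u) + ip (ι h) (ι h) := by
    rw [hg]
    simp only [map_add, LinearMap.add_apply]
    rw [hip_symm (ι h) (ι u), hipuh]
    ring
  have hEuu : E u u = ∑ i, ∑ j, α i * α j * E (v i) (v j) := by rw [hu, dt_bilin_sum_sum]
  have hipuu : ip (ι u) (ι u) = ∑ i, ∑ j, α i * α j * ip (ι (v i)) (ι (v j)) := by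
    rw [hιu, dt_bilin_sum_sum]
  have hipxx : ip (Sw x) (Sw x) = ∑ i, ∑ j, α i * α j * ip (Sw (r i)) (Sw (r j)) := by
    rw [hSx, dt_bilin_sum_sum]
  have hP : 0 ≤ E u u - lam * ip (ι u) (ι u) - ip (Sw x) (Sw x) := by
    have e : ∑ i, ∑ j, α i * α j * (E (v i) (v j) - lam * ip (ι (v i)) (ι (v j)) - ip (Sw (r i)) (Sw (r j))) =
        (∑ i, ∑ j, α i * α j * E (v i) (v j)) - lam * (∑ i, ∑ j, α i * α j * ip (ι (v i)) (ι (v j))) -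
          ∑ i, ∑ j, α i * α j * ip (Sw (r i)) (Sw (r j)) := by
      simp only [Finset.mul_sum]
      rw [← Finset.sum_sub_distrib, ← Finset.sum_sub_distrib]
      refine Finset.sum_congr rfl fun i _ ↦ ?_
      rw [← Finset.sum_sub_distrib, ← Finset.sum_sub_distrib]
      exact Finset.sum_congr rfl fun j _ ↦ by ring
    have h0 := hPSD α
    rw [e] at h0
    rw [hEuu, hipuu, hipxx]
    linarith
  -- pointwise completion of the square: `0 ≤ ip (S_w x + S_n ιh) (S_w x + S_n ιh)`
  have hsq : 0 ≤ ip (Sw x) (Sw x) + 2 * ip x (ι h) + ip (Sn (ι h)) (Sn (ι h)) := by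
    have e2 : ip (Sw x) (Sw x) + 2 * ip x (ι h) + ip (Sn (ι h)) (Sn (ι h)) =
        ip (Sw x + Sn (ι h)) (Sw x + Sn (ι h)) := by
      simp only [map_add, LinearMap.add_apply]
      rw [hip_symm (Sn (ι h)) (Sw x), hS]
      ring
    rw [e2]
    exact hip_nonneg _
  have hβ := hbeta h horth
  rw [hEgg, hipgg]
  linarith

/-! ## Multiplication by a bounded real weight on `L²` -/

/-- `y ↦ u(y) · f(y) ∈ L²` for a measurable real `u` with `|u| ≤ C` and `f ∈ L²`. [folklore] -/
theorem dt_memLp_real_mul {u : ℝ → ℝ} (hu : Measurable u) {C : ℝ} (huC : ∀ y, |u y| ≤ C) {f : ℝ → ℂ}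
    (hf : MemLp f 2) : MemLp (fun y ↦ ((u y : ℝ) : ℂ) * f y) 2 := by
  refine hf.of_le_mul (c := C) ((Complex.measurable_ofReal.comp hu).aestronglyMeasurable.mul hf.1)
    (Eventually.of_forall fun y ↦ ?_)
  rw [norm_mul, Complex.norm_real, Real.norm_eq_abs]
  exact mul_le_mul_of_nonneg_right (huC y) (norm_nonneg _)

/-- The weighted pairing in product form: `Re((√u·f)(y) · conj((√u·g)(y))) = u(y) Re(f(y) ḡ(y))` for `u ≥ 0`. [folklore] -/
theorem dt_sqrt_mul_pairing_pt {u : ℝ → ℝ} (hu : ∀ y, 0 ≤ u y) (f g : ℝ → ℂ) (y : ℝ) :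
    ((((Real.sqrt (u y) : ℝ) : ℂ) * f y) * conj ((((Real.sqrt (u y) : ℝ) : ℂ) * g y))).re =
      u y * (f y * conj (g y)).re := by
  rw [map_mul, Complex.conj_ofReal]
  have e : (((Real.sqrt (u y) : ℝ) : ℂ) * f y) * (((Real.sqrt (u y) : ℝ) : ℂ) * conj (g y)) =
      (((Real.sqrt (u y) * Real.sqrt (u y) : ℝ)) : ℂ) * (f y * conj (g y)) := by push_cast; ring
  rw [e, Real.mul_self_sqrt (hu y), Complex.re_ofReal_mul]

/-- The mixed pairing collapses: `Re((√w·f)(y) · conj((√n·g)(y))) = Re(f(y) ḡ(y))` when `w, n ≥ 0`, `w n = 1`. [folklore] -/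
theorem dt_sqrt_mixed_pairing_pt {w n : ℝ → ℝ} (hw : ∀ y, 0 ≤ w y) (hwn : ∀ y, w y * n y = 1) (f g : ℝ → ℂ) (y : ℝ) :
    ((((Real.sqrt (w y) : ℝ) : ℂ) * f y) * conj ((((Real.sqrt (n y) : ℝ) : ℂ) * g y))).re = (f y * conj (g y)).re := by
  rw [map_mul, Complex.conj_ofReal]
  have e : (((Real.sqrt (w y) : ℝ) : ℂ) * f y) * (((Real.sqrt (n y) : ℝ) : ℂ) * conj (g y)) =
      (((Real.sqrt (w y) * Real.sqrt (n y) : ℝ)) : ℂ) * (f y * conj (g y)) := by push_cast; ring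
  rw [e, ← Real.sqrt_mul (hw y), hwn y, Real.sqrt_one]
  simp

/-! ## The weighted inclusion on the sector form domain -/

/-- **Deflated Temple inclusion with a pointwise complement level.**  Let `c > 0`, `σ ∈ ℂ`, trial vectors
`v_i ∈ D_c^σ` with window images `F_i ∈ L²` (as in `dt_deflation_core`), a coefficient matrix `W`, real `λ`, and
bounded measurable weights `n ≥ 0`, `w ≥ 0` with `w n = 1`.  If `∫ n|h|² + λ ∫|h|² ≤ P(h) + 𝓔_c(h) − M_c∫|h|²` for every
`h ∈ D_c^σ` with `h ⊥ v`, and `A − λG − R_w ⪰ 0` with `R_w,ij = ∫ w · Re(r_i r̄_j)`, `r_i = F_i − Σ_l W_il v_l`, then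
`λ ∫|g|² ≤ P(g) + 𝓔_c(g) − M_c∫|g|²` for every `g ∈ D_c^σ`. [cite: WeinsteinStenger1972, Ch. 5 §9 eq. (2) (k = 1: Temple's formula)] -/
theorem dt_deflation_core_w {c : ℝ} (σ : ℂ) {k : ℕ} (v F : Fin k → ℝ → ℂ) (W : Fin k → Fin k → ℝ) (lam : ℝ)
    {n w : ℝ → ℝ} (hnm : Measurable n) (hwm : Measurable w) {C : ℝ} (hnC : ∀ y, |n y| ≤ C) (hwC : ∀ y, |w y| ≤ C)
    (hn0 : ∀ y, 0 ≤ n y) (hw0 : ∀ y, 0 ≤ w y) (hwn : ∀ y, w y * n y = 1)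
    (hv : ∀ i, MemLp (v i) 2 ∧ (∀ x, x ∉ Icc (-c) c → v i x = 0) ∧ (∀ x, (v i x).im = 0) ∧
      (∀ x, v i (-x) = σ * v i x) ∧ IntegrableOn (fun t ↦ weilArchDensity t * weilIncrement (v i) t) (Ioi 0))
    (hF : ∀ i, MemLp (F i) 2)
    (hrepr : ∀ i (f : ℝ → ℂ), MemLp f 2 → (∀ x, x ∉ Icc (-c) c → f x = 0) → (∀ x, (f x).im = 0) →
      (∀ x, f (-x) = σ * f x) → IntegrableOn (fun t ↦ weilArchDensity t * weilIncrement f t) (Ioi 0) →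
      weilPoleForm₂ (v i) f + weilDirichletEnergy₂ c (v i) f -
          weilMarkovConstant c * ∫ x, (v i x * conj (f x)).re = ∫ x, (F i x * conj (f x)).re)
    (hbeta : ∀ h : ℝ → ℂ, MemLp h 2 → (∀ x, x ∉ Icc (-c) c → h x = 0) → (∀ x, (h x).im = 0) →
      (∀ x, h (-x) = σ * h x) → IntegrableOn (fun t ↦ weilArchDensity t * weilIncrement h t) (Ioi 0) →
      (∀ j, ∫ x, (v j x * conj (h x)).re = 0) →
      (∫ y, n y * ‖h y‖ ^ 2) + lam * ∫ y, ‖h y‖ ^ 2 ≤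
        weilPoleForm h + weilDirichletEnergy c h - weilMarkovConstant c * ∫ x, ‖h x‖ ^ 2)
    (hPSD : ∀ α : Fin k → ℝ, 0 ≤ ∑ i, ∑ j, α i * α j *
      ((weilPoleForm₂ (v i) (v j) + weilDirichletEnergy₂ c (v i) (v j) -
          weilMarkovConstant c * ∫ x, (v i x * conj (v j x)).re) - lam * (∫ x, (v i x * conj (v j x)).re) -
        ∫ y, w y * ((F i - ∑ l, W i l • v l) y * conj ((F j - ∑ l, W j l • v l) y)).re))
    {g : ℝ → ℂ} (hg : MemLp g 2) (hgs : ∀ x, x ∉ Icc (-c) c → g x = 0) (hgr : ∀ x, (g x).im = 0)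
    (hgp : ∀ x, g (-x) = σ * g x)
    (hgE : IntegrableOn (fun t ↦ weilArchDensity t * weilIncrement g t) (Ioi 0)) :
    lam * ∫ x, ‖g x‖ ^ 2 ≤
      weilPoleForm g + weilDirichletEnergy c g - weilMarkovConstant c * ∫ x, ‖g x‖ ^ 2 := by
  classical
  -- the ambient space `D' = L²` (as functions) and the sector form domain `D ⊆ D'` (verbatim from file III)
  let D' : Submodule ℝ (ℝ → ℂ) :=
    { carrier := {f | MemLp f 2 volume}
      add_mem' := fun {f₁ f₂} h₁ h₂ ↦ MemLp.add h₁ h₂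
      zero_mem' := MemLp.zero
      smul_mem' := fun a f hf ↦ by
        have e : a • f = fun x ↦ (a : ℂ) * f x := funext fun x ↦ dt_smul_apply a f x
        rw [e]
        exact hf.const_mul _ }
  let D : Submodule ℝ (ℝ → ℂ) :=
    { carrier := {f | MemLp f 2 volume ∧ (∀ x, x ∉ Icc (-c) c → f x = 0) ∧ (∀ x, (f x).im = 0) ∧
        (∀ x, f (-x) = σ * f x) ∧ IntegrableOn (fun t ↦ weilArchDensity t * weilIncrement f t) (Ioi 0)}
      add_mem' := fun {f₁ f₂} h₁ h₂ ↦ ⟨h₁.1.add h₂.1, fun x hx ↦ by simp [h₁.2.1 x hx, h₂.2.1 x hx],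
        fun x ↦ by simp [h₁.2.2.1 x, h₂.2.2.1 x], fun x ↦ by
          simp only [Pi.add_apply, h₁.2.2.2.1 x, h₂.2.2.2.1 x]; ring,
        dt_finiteEnergy_add h₁.1 h₂.1 h₁.2.2.2.2 h₂.2.2.2.2⟩
      zero_mem' := ⟨MemLp.zero, fun _ _ ↦ rfl, fun _ ↦ rfl, fun _ ↦ by simp, dt_finiteEnergy_zero⟩
      smul_mem' := fun a f hf ↦ ⟨by
          have e : a • f = fun x ↦ (a : ℂ) * f x := funext fun x ↦ dt_smul_apply a f x
          rw [e]; exact hf.1.const_mul _,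
        fun x hx ↦ by simp [hf.2.1 x hx], fun x ↦ by simp [hf.2.2.1 x],
        fun x ↦ by rw [dt_smul_apply, dt_smul_apply, hf.2.2.2.1 x]; ring,
        dt_finiteEnergy_smul a f hf.2.2.2.2⟩ }
  have hDD' : D ≤ D' := fun f hf ↦ hf.1
  let ι : D →ₗ[ℝ] D' := Submodule.inclusion hDD'
  -- the pairing on `D'`
  let ip : D' →ₗ[ℝ] D' →ₗ[ℝ] ℝ := LinearMap.mk₂ ℝ
    (fun f h ↦ ∫ x, ((f : ℝ → ℂ) x * conj ((h : ℝ → ℂ) x)).re)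
    (fun f₁ f₂ h ↦ by
      simp only [Submodule.coe_add]
      exact dt_pairing_add_left f₁.2 f₂.2 h.2)
    (fun a f h ↦ by
      simp only [Submodule.coe_smul, smul_eq_mul]
      exact dt_pairing_smul_left a _ _)
    (fun f h₁ h₂ ↦ by
      simp only [Submodule.coe_add]
      rw [dt_pairing_comm, dt_pairing_add_left h₁.2 h₂.2 f.2, dt_pairing_comm (h₁ : ℝ → ℂ),
        dt_pairing_comm (h₂ : ℝ → ℂ)])
    (fun a f h ↦ by
      simp only [Submodule.coe_smul, smul_eq_mul]
      rw [dt_pairing_comm, dt_pairing_smul_left, dt_pairing_comm])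
  have hip : ∀ f h : D', ip f h = ∫ x, ((f : ℝ → ℂ) x * conj ((h : ℝ → ℂ) x)).re := fun f h ↦ rfl
  -- multiplication by `√u` on `D'` (`u = w` or `n`)
  have hsqC : ∀ {u : ℝ → ℝ}, (∀ y, |u y| ≤ C) → ∀ y, |Real.sqrt (u y)| ≤ Real.sqrt C := fun huC y ↦ by
    rw [abs_of_nonneg (Real.sqrt_nonneg _)]
    exact Real.sqrt_le_sqrt ((le_abs_self _).trans (huC y))
  let S : ∀ u : ℝ → ℝ, Measurable u → (∀ y, |u y| ≤ C) → (D' →ₗ[ℝ] D') := fun u hum huC ↦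
    { toFun := fun f ↦ ⟨fun y ↦ ((Real.sqrt (u y) : ℝ) : ℂ) * (f : ℝ → ℂ) y,
        dt_memLp_real_mul hum.sqrt (hsqC huC) f.2⟩
      map_add' := fun f₁ f₂ ↦ by
        apply Subtype.ext; funext y
        simp only [Submodule.coe_add, Pi.add_apply, mul_add]
      map_smul' := fun a f ↦ by
        apply Subtype.ext; funext y
        simp only [Submodule.coe_smul, RingHom.id_apply, dt_smul_apply]
        ring }
  have hS_apply : ∀ (u : ℝ → ℝ) (hum : Measurable u) (huC : ∀ y, |u y| ≤ C) (f : D') (y : ℝ),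
      ((S u hum huC f : D') : ℝ → ℂ) y = ((Real.sqrt (u y) : ℝ) : ℂ) * (f : ℝ → ℂ) y := fun _ _ _ _ _ ↦ rfl
  let Sw : D' →ₗ[ℝ] D' := S w hwm hwC
  let Sn : D' →ₗ[ℝ] D' := S n hnm hnC
  have hSw : ∀ (f h : D'), ip (Sw f) (Sw h) = ∫ y, w y * ((f : ℝ → ℂ) y * conj ((h : ℝ → ℂ) y)).re := by
    intro f h; rw [hip]
    exact integral_congr_ae (Eventually.of_forall fun y ↦ by
      simp only [Sw, hS_apply]; exact dt_sqrt_mul_pairing_pt hw0 _ _ y)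
  have hSn : ∀ (h : D'), ip (Sn h) (Sn h) = ∫ y, n y * ‖(h : ℝ → ℂ) y‖ ^ 2 := by
    intro h; rw [hip]
    exact integral_congr_ae (Eventually.of_forall fun y ↦ by
      simp only [Sn, hS_apply]; rw [dt_sqrt_mul_pairing_pt hn0 _ _ y, re_mul_conj_self])
  have hSmix : ∀ (f h : D'), ip (Sw f) (Sn h) = ip f h := by
    intro f h; rw [hip, hip]
    exact integral_congr_ae (Eventually.of_forall fun y ↦ by
      simp only [Sw, Sn, hS_apply]; exact dt_sqrt_mixed_pairing_pt hw0 hwn _ _ y)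
  -- the closed form on `D` (verbatim from file III)
  let E : D →ₗ[ℝ] D →ₗ[ℝ] ℝ := LinearMap.mk₂ ℝ
    (fun f h ↦ weilPoleForm₂ (f : ℝ → ℂ) h + weilDirichletEnergy₂ c (f : ℝ → ℂ) h -
      weilMarkovConstant c * ∫ x, ((f : ℝ → ℂ) x * conj ((h : ℝ → ℂ) x)).re)
    (fun f₁ f₂ h ↦ by
      simp only [Submodule.coe_add]
      exact dt_closedForm_add_left c f₁.2.1 f₂.2.1 h.2.1 f₁.2.2.1 f₂.2.2.1 f₁.2.2.2.2.2 f₂.2.2.2.2.2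
        h.2.2.2.2.2)
    (fun a f h ↦ by
      simp only [Submodule.coe_smul, smul_eq_mul]
      exact dt_closedForm_smul_left c a _ _)
    (fun f h₁ h₂ ↦ by
      simp only [Submodule.coe_add]
      rw [dt_closedForm_comm, dt_closedForm_add_left c h₁.2.1 h₂.2.1 f.2.1 h₁.2.2.1 h₂.2.2.1 h₁.2.2.2.2.2
        h₂.2.2.2.2.2 f.2.2.2.2.2, dt_closedForm_comm c (h₁ : ℝ → ℂ), dt_closedForm_comm c (h₂ : ℝ → ℂ)])
    (fun a f h ↦ by
      simp only [Submodule.coe_smul, smul_eq_mul]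
      rw [dt_closedForm_comm, dt_closedForm_smul_left, dt_closedForm_comm])
  have hE : ∀ f h : D, E f h = weilPoleForm₂ (f : ℝ → ℂ) h + weilDirichletEnergy₂ c (f : ℝ → ℂ) h -
      weilMarkovConstant c * ∫ x, ((f : ℝ → ℂ) x * conj ((h : ℝ → ℂ) x)).re := fun f h ↦ rfl
  -- the vectors
  let vD : Fin k → D := fun i ↦ ⟨v i, hv i⟩
  let FD : Fin k → D' := fun i ↦ ⟨F i, hF i⟩
  let rD : Fin k → D' := fun i ↦ FD i - ∑ l, W i l • ι (vD l)
  have hgD : g ∈ D := ⟨hg, hgs, hgr, hgp, hgE⟩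
  -- the decomposition
  obtain ⟨α, hα⟩ := dt_exists_orthogonal_decomp v (fun i ↦ (hv i).1) (fun i ↦ (hv i).2.2.1) hg hgr
  have hhD : g - ∑ i, α i • v i ∈ D :=
    D.sub_mem hgD (D.sum_mem fun i _ ↦ D.smul_mem (α i) (hv i))
  let gD : D := ⟨g, hgD⟩
  let hD : D := ⟨g - ∑ i, α i • v i, hhD⟩
  have hdecomp : gD = (∑ i, α i • vD i) + hD := by
    apply Subtype.ext
    simp only [Submodule.coe_add, Submodule.coe_sum, Submodule.coe_smul, gD, hD, vD]
    abel
  have hcoeι : ∀ f : D, ((ι f : D') : ℝ → ℂ) = (f : ℝ → ℂ) := fun f ↦ rfl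
  have horth : ∀ j, ip (ι (vD j)) (ι hD) = 0 := fun j ↦ by
    rw [hip, hcoeι, hcoeι]; exact hα j
  have hcoer : ∀ i, ((rD i : D') : ℝ → ℂ) = F i - ∑ l, W i l • v l := fun i ↦ by
    simp only [rD, FD, Submodule.coe_sub, Submodule.coe_sum, Submodule.coe_smul, hcoeι, vD]
  -- apply the abstract lemma
  have key := dt_deflatedFormBound₂W ι ip E
    (fun x y ↦ by rw [hip, hip, dt_pairing_comm])
    (fun x ↦ by rw [hip]; exact dt_pairing_self_nonneg _)
    (fun x y ↦ by rw [hE, hE, dt_closedForm_comm])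
    Sw Sn hSmix vD rD lam ?_ ?_ ?_ hdecomp horth
  · -- conclusion
    rw [hip, hE, hcoeι] at key
    simpa only [gD, weilPoleForm₂_self, weilDirichletEnergy₂_self, dt_pairing_self] using key
  · -- (repr)
    intro i h hh
    have h0 : ∀ l, ∫ x, (v l x * conj ((h : ℝ → ℂ) x)).re = 0 := fun l ↦ by
      have := hh l; rwa [hip, hcoeι, hcoeι] at this
    rw [hE, hrepr i h h.2.1 h.2.2.1 h.2.2.2.1 h.2.2.2.2.1 h.2.2.2.2.2]
    rw [show ip (rD i) (ι h) = ip (FD i) (ι h) - ∑ l, W i l * ip (ι (vD l)) (ι h) by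
      simp only [rD, map_sub, LinearMap.sub_apply, dt_bilin_sum_smul_left]]
    have hF0 : ip (FD i) (ι h) = ∫ x, (F i x * conj ((h : ℝ → ℂ) x)).re := rfl
    have hv0 : ∀ l, ip (ι (vD l)) (ι h) = 0 := fun l ↦ by rw [hip, hcoeι, hcoeι]; exact h0 l
    simp only [hF0, hv0, mul_zero, Finset.sum_const_zero, sub_zero]
  · -- (weighted β)
    intro h hh
    have h0 : ∀ l, ∫ x, (v l x * conj ((h : ℝ → ℂ) x)).re = 0 := fun l ↦ by
      have := hh l; rwa [hip, hcoeι, hcoeι] at this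
    rw [hSn, hip, hE, hcoeι, dt_closedForm_self, dt_pairing_self]
    exact hbeta h h.2.1 h.2.2.1 h.2.2.2.1 h.2.2.2.2.1 h.2.2.2.2.2 h0
  · -- (PSD)
    intro α'
    have e : ∀ i j, E (vD i) (vD j) - lam * ip (ι (vD i)) (ι (vD j)) - ip (Sw (rD i)) (Sw (rD j)) =
        (weilPoleForm₂ (v i) (v j) + weilDirichletEnergy₂ c (v i) (v j) -
          weilMarkovConstant c * ∫ x, (v i x * conj (v j x)).re) - lam * (∫ x, (v i x * conj (v j x)).re) -
        ∫ y, w y * ((F i - ∑ l, W i l • v l) y * conj ((F j - ∑ l, W j l • v l) y)).re := by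
      intro i j
      rw [hE, hip, hSw, hcoeι, hcoeι, hcoer, hcoer]
    simp only [e]
    exact hPSD α'

end Summit.RiemannHypothesis.RiemannHypothesis.Theorems.EvenWinsBeyondArch

end
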